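import Mathlib
import Literature.AlgebraicGeometry.Resolution.AugmentationIdeal
import Literature.AlgebraicGeometry.Resolution.AffineBlowup
import Literature.AlgebraicGeometry.Resolution.FiniteQuotientSingularityPresentation
import Summits.ResolutionOfSingularities.ResolutionOfSingularities.Theorems.WildQuotientsWildQuotientResolutionFixedPointsGraded
import Summits.ResolutionOfSingularities.ResolutionOfSingularities.Theorems.WildQuotientsWildQuotientResolutionInvolutionOnInvariants
import Summits.ResolutionOfSingularities.ResolutionOfSingularities.Theorems.WildQuotientsWildQuotientResolutionInvolutionBlowupRegularTwice
import Summits.ResolutionOfSingularities.ResolutionOfSingularities.Theorems.WildQuotientsWildQuotientResolutionJordanFiveMu2CoverDefs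
import Summits.ResolutionOfSingularities.ResolutionOfSingularities.Theorems.WildQuotientsWildQuotientResolutionJordanFiveMu2CoverAction
import Summits.ResolutionOfSingularities.ResolutionOfSingularities.Theorems.WildQuotientsWildQuotientResolutionJordanFiveMu2CoverActionExists
import Summits.ResolutionOfSingularities.ResolutionOfSingularities.Theorems.WildQuotientsWildQuotientResolutionJordanFiveMu2CoverDescent
import Summits.ResolutionOfSingularities.ResolutionOfSingularities.Theorems.WildQuotientsWildQuotientResolutionJordanFiveMu2CoverKL
import Summits.ResolutionOfSingularities.ResolutionOfSingularities.Theorems.WildQuotientsWildQuotientResolutionJordanFiveMu2CoverIrreducible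
import Summits.ResolutionOfSingularities.ResolutionOfSingularities.Theorems.WildQuotientsWildQuotientResolutionJordanFiveMu2CoverRegular
import Summits.ResolutionOfSingularities.ResolutionOfSingularities.Theorems.WildQuotientsWildQuotientResolutionJordanFiveMu2CoverInvariantsRegular
import Summits.ResolutionOfSingularities.ResolutionOfSingularities.Theorems.WildQuotientsWildQuotientResolutionJordanFiveMu2CoverSubstDefs
import Summits.ResolutionOfSingularities.ResolutionOfSingularities.Theorems.WildQuotientsWildQuotientResolutionJordanFiveMu2CoverSubst
import Summits.ResolutionOfSingularities.ResolutionOfSingularities.Theorems.WildQuotientsWildQuotientResolutionJordanFiveMu2CoverBridge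
import Summits.ResolutionOfSingularities.ResolutionOfSingularities.Theorems.WildQuotientsWildQuotientResolutionJordanFourHalfChartRing
import Summits.ResolutionOfSingularities.ResolutionOfSingularities.Theorems.WildQuotientsWildQuotientResolutionJordanFiveFrameDefs
import Summits.ResolutionOfSingularities.ResolutionOfSingularities.Theorems.WildQuotientsWildQuotientResolutionJordanFiveTwistedChartDefs

/-!
# RUNG V5 (`J₅`), brick B7/HP₂ — the ring-side MODEL BRICK `exists_ringBrick_HP2_model`

Sub-problem `ResolutionOfSingularities`, crux `WildQuotients.WildQuotientResolution`
(stmt-ResolutionOfSingularities-15640), line L1 W4.5c, scaffold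
`JordanFive.jordanFive_hasResolution_of_bricks` (p527978) / `coneBrick_two_of_ringBrick` (p534266,
the `H₂` binder), res-L1-w45c-plan-1 RULING 14:04:47Z (the model-brick cut; J₄ precedent
`JordanFour.exists_ringBrick_T_model`, p510790). [OURS · L1 W4.5c] — NOT a statement of any manuscript.

**`JordanFive.exists_ringBrick_HP2_model`.**  Let `U` be a localisation of `k[s,Y,pass] ⧸ I` away
from `ι`, `I = (Φ)`, `ι = î` (the twisted-root cover `U₂` of the `μ₂`-vertex chart `W₂`, `p ≥ 5`),
`σ_U` a `k`-automorphism with the cover laws, `τ_U` one with the deck laws, and let a ring `C` be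
identified with the `τ_U`-invariants `E = U^{⟨τ_U⟩}` by `eE : C ≃+* E` so that `base : k[x] → C` becomes
the cover substitution (`hbase`).  Then for any chart ratios `t_j ∈ C` (`j ∉ {0,2,5,13}`,
`base(i₂³)·t_j = base(g_j)`) there are `R₀ = (U^{⟨σ_U⟩})^{⟨τ̄⟩}`, the injective
`ψC : R₀ → C` (through `eE⁻¹`) with range the `σ_U`-invariants of `C`, and the radical ideal
`J₀ = √(ψC⁻¹⟨base x_a, …, base x_d, t_j⟩)` whose affine blow-up is REGULAR:
(α)+(β) `U^{⟨σ_U⟩}` regular (K–L at `p`, p535453/p537496) · (γ) `J₀ = I_{τ̄} ∩ R₀`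
(centre dictionary p538060 + bridge p539475 + radicals descend along the integral model `E ⊆ U`,
`JordanFour.mem_radical_span_of_model`) · (δ) K–L twice, step 2 (res-L1-w45c-stub-3's
`InvolutionExit.isRegular_affineBlowup_comap_augIdeal_twice`, p539206).
-/

-- single-problem summit: the doubled namespace component `ResolutionOfSingularities` is forced
set_option linter.dupNamespace false

noncomputable section

open MvPolynomial AlgebraicGeometry Literature.AlgebraicGeometry.Resolution
open Summit.ResolutionOfSingularities.ResolutionOfSingularities.Theorems.WildQuotientResolution.TameTransfer
  (mem_fixedPoints_zpowers_iff_apply_eq)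

namespace Summit.ResolutionOfSingularities.ResolutionOfSingularities.Theorems.WildQuotientResolution.JordanFive

variable (k : Type) [Field k] (n : ℕ) (a b c d e : Fin n)
  (hab : a ≠ b) (hac : a ≠ c) (had : a ≠ d) (hae : a ≠ e) (hbc : b ≠ c) (hbd : b ≠ d)
  (hbe : b ≠ e) (hcd : c ≠ d) (hce : c ≠ e) (hde : d ≠ e)
  (I : Ideal (MvPolynomial (Option (Fin n)) k)) (ι : MvPolynomial (Option (Fin n)) k)
  (hI : I = Ideal.span {coverPhi (X none) (X (some a)) (X (some b)) (X (some c)) (X (some d))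
    (X (some e) : MvPolynomial (Option (Fin n)) k)})
  (hι : ι = coverIHat (X none) (X (some a)) (X (some b)) (X (some c)) (X (some d)) (X (some e)))
  (U : Type) [CommRing U] [Algebra (MvPolynomial (Option (Fin n)) k ⧸ I) U]
  [IsLocalization.Away (Ideal.Quotient.mk I ι) U] [Algebra k U]
  [IsScalarTower k (MvPolynomial (Option (Fin n)) k ⧸ I) U]

include hab hac had hae hbc hbd hbe hcd hce hde hI hι in
-- the statement quantifies over the seam's data; elaboration needs head-room
set_option maxHeartbeats 1600000 in
/-- **The ring-side model brick `H₂` of RUNG V5** (see the module docstring). [OURS · L1 W4.5c]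
[folklore; assembly of landed decls] -/
theorem exists_ringBrick_HP2_model {p : ℕ} [CharP k p] (hp : p.Prime) (hp5 : 5 ≤ p)
    (σU : U ≃ₐ[k] U)
    (hs : σU (algebraMap _ U (Ideal.Quotient.mk I (X none))) =
      algebraMap _ U (Ideal.Quotient.mk I (X none)))
    (h1 : σU (algebraMap _ U (Ideal.Quotient.mk I (X (some b)))) =
      algebraMap _ U (Ideal.Quotient.mk I (X (some b))) +
        algebraMap _ U (Ideal.Quotient.mk I (X none)) *
          algebraMap _ U (Ideal.Quotient.mk I (X (some a))))
    (h2 : σU (algebraMap _ U (Ideal.Quotient.mk I (X (some c)))) =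
      algebraMap _ U (Ideal.Quotient.mk I (X (some c))) +
        algebraMap _ U (Ideal.Quotient.mk I (X none)) *
          algebraMap _ U (Ideal.Quotient.mk I (X (some b))))
    (h3 : σU (algebraMap _ U (Ideal.Quotient.mk I (X (some d)))) =
      algebraMap _ U (Ideal.Quotient.mk I (X (some d))) +
        algebraMap _ U (Ideal.Quotient.mk I (X none)) *
          algebraMap _ U (Ideal.Quotient.mk I (X (some c))))
    (h4 : σU (algebraMap _ U (Ideal.Quotient.mk I (X (some e)))) =
      algebraMap _ U (Ideal.Quotient.mk I (X (some e))) +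
        algebraMap _ U (Ideal.Quotient.mk I (X none)) *
          algebraMap _ U (Ideal.Quotient.mk I (X (some d))))
    (hσ : ∀ i, i ≠ b → i ≠ c → i ≠ d → i ≠ e →
      σU (algebraMap _ U (Ideal.Quotient.mk I (X (some i)))) =
        algebraMap _ U (Ideal.Quotient.mk I (X (some i))))
    (τU : U ≃ₐ[k] U)
    (τs : τU (algebraMap _ U (Ideal.Quotient.mk I (X none))) =
      -algebraMap _ U (Ideal.Quotient.mk I (X none)))
    (τb : τU (algebraMap _ U (Ideal.Quotient.mk I (X (some b)))) =
      -algebraMap _ U (Ideal.Quotient.mk I (X (some b))))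
    (τd : τU (algebraMap _ U (Ideal.Quotient.mk I (X (some d)))) =
      -algebraMap _ U (Ideal.Quotient.mk I (X (some d))))
    (τi : ∀ i, i ≠ b → i ≠ d → τU (algebraMap _ U (Ideal.Quotient.mk I (X (some i)))) =
      algebraMap _ U (Ideal.Quotient.mk I (X (some i))))
    {C : Type} [CommRing C] (base : MvPolynomial (Fin n) k →+* C)
    (eE : C ≃+* FixedPoints.subalgebra k U (Subgroup.zpowers τU))
    (hbase : ∀ F, ((eE (base F) : FixedPoints.subalgebra k U (Subgroup.zpowers τU)) : U) =
      algebraMap _ U (Ideal.Quotient.mk I (coverSubst k n a b c d F)))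
    (t : {j : Fin 40 // j ≠ 0 ∧ j ≠ 2 ∧ j ≠ 5 ∧ j ≠ 13} → C)
    (ht : ∀ j, base (iTwo k n a b c d e ^ 3) * t j = base (gens12 k n a b c d j.1)) :
    ∃ (R₀ : Type) (_ : CommRing R₀) (J₀ : Ideal R₀) (ψC : R₀ →+* C),
      Function.Injective ψC ∧
      (∀ y, y ∈ Set.range ψC ↔
        σU ((eE y : FixedPoints.subalgebra k U (Subgroup.zpowers τU)) : U) =
          ((eE y : FixedPoints.subalgebra k U (Subgroup.zpowers τU)) : U)) ∧
      J₀.IsRadical ∧ Scheme.IsRegular (affineBlowup J₀) ∧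
      ((Ideal.span (base '' {X a, X b, X c, X d} ∪ Set.range t)).comap ψC).radical = J₀ := by
  classical
  -- ### constants
  have h2k : (2 : k) ≠ 0 := two_ne_zero_of_five_le k p hp hp5
  have h3k : (3 : k) ≠ 0 := three_ne_zero_of_five_le k p hp hp5
  -- ### the cover `U`: domain, regular, finite type
  haveI : IsDomain (MvPolynomial (Option (Fin n)) k ⧸ I) := by
    rw [hI]; exact isDomain_quotient_coverPhi k n a b c d e hab hac hae hbc hbe hce hde h2k h3k
  have hιI : ι ∉ I := by
    rw [hI, hι]; exact coverIHat_notMem_span_coverPhi k n a b c d e hac hbc hcd hce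
  haveI : IsDomain U := away_quotient_isDomain k n I ι U hιI
  haveI : IsRegularRing U := by
    have hL : IsRegularRing (Localization.Away (Ideal.Quotient.mk I ι)) := by
      subst hI hι
      exact isRegularRing_away_coverIHat k n a b c d e hab hac had hae hbc hbd hbe hcd hce hde h2k
    exact IsRegularRing.of_ringEquiv (R := Localization.Away (Ideal.Quotient.mk I ι))
      (IsLocalization.algEquiv (Submonoid.powers (Ideal.Quotient.mk I ι))
        (Localization.Away (Ideal.Quotient.mk I ι)) U).toRingEquiv
  haveI : Algebra.FiniteType k U := away_quotient_finiteType k n I ι U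
  have hunit : IsUnit (algebraMap _ U (Ideal.Quotient.mk I ι)) :=
    IsLocalization.Away.algebraMap_isUnit (Ideal.Quotient.mk I ι)
  -- ### `σ_U`: `ι` fixed, `s·Y₀ ≠ 0`, the invariants are regular, `σ_U ^ p = 1`
  obtain ⟨σA, hAs, hA1, hA2, hA3, hA4, hAσ⟩ :=
    exists_coverSigma k n a b c d e hab hac had hae hbc hbd hbe hcd hce hde
  have hcomp := cover_laws_comp k n a b c d e I U σU σA hs h1 h2 h3 h4 hσ hAs hA1 hA2 hA3 hA4 hAσ
  have hσι : σU (algebraMap _ U (Ideal.Quotient.mk I ι)) = algebraMap _ U (Ideal.Quotient.mk I ι) := by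
    rw [cover_apply_algebraMap_mk k n I U σU σA hcomp, hι,
      cover_apply_coverIHat k n σA a b c d e hab hac had hae hAs hA1 hA2 hA3 hA4 hAσ]
  have hιspan : ι ∈ Ideal.span ({X (some a), X (some b), X (some c), X (some d)} :
      Set (MvPolynomial (Option (Fin n)) k)) := by
    rw [hι]; exact coverIHat_mem_span _ _ _ _ _ _
  have hne : algebraMap _ U (Ideal.Quotient.mk I (X none)) *
      algebraMap _ U (Ideal.Quotient.mk I (X (some a))) ≠ 0 := by
    rw [← map_mul, ← map_mul, Ne, algebraMap_mk_eq_zero_iff k n I ι U hιI, hI]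
    exact X_none_mul_X_notMem_span_coverPhi k n a b c d e hab hac hae hbc hbe hcd hce hde h2k h3k
  have hs0 : algebraMap _ U (Ideal.Quotient.mk I (X none)) ≠ 0 := left_ne_zero_of_mul hne
  haveI hVreg : IsRegularRing (FixedPoints.subalgebra k U (Subgroup.zpowers σU)) :=
    isRegularRing_fixedPoints_cover k n a b c d e hab hac had hae hbc hbd hbe hcd hce hde I ι U hp hp5
      σU hs h1 h2 h3 h4 hσ hσι hιspan hne
  have hσp : σU ^ p = 1 :=
    cover_pow_prime_eq_one_U k n a b c d e hab hac had hae hbc hbd hbe hcd hce hde I ι U σU hs h1 h2 h3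
      h4 hσ hp hp5
  haveI : Finite (Subgroup.zpowers σU) :=
    Set.finite_coe_iff.mpr (isOfFinOrder_iff_pow_eq_one.mpr ⟨p, hp.pos, hσp⟩).finite_zpowers
  -- ### `τ_U`: `ι` fixed, involutive, commutes with `σ_U`, restricts to `τ̄`
  obtain ⟨τA, hτAs, hτAb, hτAd, hτAi, -⟩ := exists_coverTau k n b d
  have hτcomp : ∀ o, τU (algebraMap _ U (Ideal.Quotient.mk I (X o))) =
      algebraMap _ U (Ideal.Quotient.mk I (τA (X o))) := by
    rintro (_ | i)
    · rw [τs, hτAs, map_neg, map_neg]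
    · by_cases hib : i = b
      · subst hib; rw [τb, hτAb, map_neg, map_neg]
      by_cases hid : i = d
      · subst hid; rw [τd, hτAd, map_neg, map_neg]
      rw [τi i hib hid, hτAi i hib hid]
  have hτι : τU (algebraMap _ U (Ideal.Quotient.mk I ι)) = algebraMap _ U (Ideal.Quotient.mk I ι) := by
    rw [cover_apply_algebraMap_mk k n I U τU τA hτcomp, hι,
      coverTau_apply_coverIHat k n a b c d e hab had τA hτAs hτAb hτAd hτAi hbc hcd hbe hde]
  have hττ : ∀ u, τU (τU u) = u := coverTau_involutive k n b d I ι U τU τs τb τd τi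
  have hτ2 : τU ^ 2 = 1 := by
    ext u; rw [pow_two, AlgEquiv.mul_apply, hττ, AlgEquiv.one_apply]
  haveI : Finite (Subgroup.zpowers τU) :=
    Set.finite_coe_iff.mpr (isOfFinOrder_iff_pow_eq_one.mpr ⟨2, two_pos, hτ2⟩).finite_zpowers
  have hcomm : ∀ u, σU (τU u) = τU (σU u) :=
    cover_comm_coverTau_apply k n a b c d e hab hac had hae hbc hbe hcd hde I ι U σU hs h1 h2 h3 h4 hσ τU
      τs τb τd τi
  obtain ⟨τbar, hτbar⟩ := InvolutionExit.exists_restrict_fixedPoints σU τU hcomm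
  have htbtb : ∀ v, τbar (τbar v) = v := InvolutionExit.restrict_involutive σU τU τbar hτbar hττ
  -- ### `R₀ = (U^σ)^τ̄` and `ψC`
  have hmemE : ∀ r : FixedPoints.subalgebra k (FixedPoints.subalgebra k U (Subgroup.zpowers σU))
      (Subgroup.zpowers τbar),
      (((FixedPoints.subalgebra k U (Subgroup.zpowers σU)).val.toRingHom.comp
        (FixedPoints.subalgebra k (FixedPoints.subalgebra k U (Subgroup.zpowers σU))
          (Subgroup.zpowers τbar)).val.toRingHom) r) ∈
        FixedPoints.subalgebra k U (Subgroup.zpowers τU) := by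
    intro r
    change ((r : FixedPoints.subalgebra k U (Subgroup.zpowers σU)) : U) ∈ _
    rw [mem_fixedPoints_zpowers_iff_apply_eq, ← hτbar]
    have hr := (mem_fixedPoints_zpowers_iff_apply_eq τbar
      (r : FixedPoints.subalgebra k U (Subgroup.zpowers σU))).mp r.2
    rw [hr]
  let incl : FixedPoints.subalgebra k (FixedPoints.subalgebra k U (Subgroup.zpowers σU))
      (Subgroup.zpowers τbar) →+* FixedPoints.subalgebra k U (Subgroup.zpowers τU) :=
    ((FixedPoints.subalgebra k U (Subgroup.zpowers σU)).val.toRingHom.comp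
      (FixedPoints.subalgebra k (FixedPoints.subalgebra k U (Subgroup.zpowers σU))
        (Subgroup.zpowers τbar)).val.toRingHom).codRestrict
      (FixedPoints.subalgebra k U (Subgroup.zpowers τU)) hmemE
  have hincl : ∀ r, ((incl r : FixedPoints.subalgebra k U (Subgroup.zpowers τU)) : U) =
      ((r : FixedPoints.subalgebra k U (Subgroup.zpowers σU)) : U) := fun r => rfl
  let ψC : FixedPoints.subalgebra k (FixedPoints.subalgebra k U (Subgroup.zpowers σU))
      (Subgroup.zpowers τbar) →+* C := eE.symm.toRingHom.comp incl
  have hψ : ∀ r, eE (ψC r) = incl r := fun r => by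
    change eE (eE.symm (incl r)) = incl r
    exact eE.apply_symm_apply _
  have hψval : ∀ r, ((eE (ψC r) : FixedPoints.subalgebra k U (Subgroup.zpowers τU)) : U) =
      ((r : FixedPoints.subalgebra k U (Subgroup.zpowers σU)) : U) := fun r => by
    rw [hψ, hincl]
  -- the ring map `θU : C → U` through `eE` and the pulled-back centre in `U`
  let θU : C →+* U := (FixedPoints.subalgebra k U (Subgroup.zpowers τU)).val.toRingHom.comp
    eE.toRingHom
  have hθU : ∀ y, θU y = ((eE y : FixedPoints.subalgebra k U (Subgroup.zpowers τU)) : U) :=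
    fun y => rfl
  have hθψ : ∀ r, θU (ψC r) = ((r : FixedPoints.subalgebra k U (Subgroup.zpowers σU)) : U) :=
    fun r => by rw [hθU, hψval]
  have hθbase : ∀ F, θU (base F) = algebraMap _ U (Ideal.Quotient.mk I (coverSubst k n a b c d F)) :=
    fun F => by rw [hθU, hbase]
  -- ### the centre: radicals in `C`, in `U`, and `I_{τ̄}`
  set K : Ideal C := Ideal.span (base '' {X a, X b, X c, X d} ∪ Set.range t) with hK
  -- the structure map `θ : k[s,Y,pass] → U` and the image of the generators in `U`
  let θ : MvPolynomial (Option (Fin n)) k →+* U :=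
    (algebraMap (MvPolynomial (Option (Fin n)) k ⧸ I) U).comp (Ideal.Quotient.mk I)
  have hθ : ∀ x, θ x = algebraMap _ U (Ideal.Quotient.mk I x) := fun x => rfl
  have himage : (fun z => ((eE z : FixedPoints.subalgebra k U (Subgroup.zpowers τU)) : U)) ''
      (base '' {X a, X b, X c, X d} ∪ Set.range t) =
      (fun F => θ (coverSubst k n a b c d F)) '' {X a, X b, X c, X d} ∪
        Set.range (fun j => θU (t j)) := by
    rw [Set.image_union, Set.image_image, ← Set.range_comp]
    congr 1
    refine Set.image_congr' fun F => ?_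
    rw [← hθU, hθbase, hθ]
  have hu : ∀ j, θ (coverSubst k n a b c d (iTwo k n a b c d e ^ 3)) * θU (t j) =
      θ (coverSubst k n a b c d (gens12 k n a b c d j.1)) := by
    intro j
    rw [hθ, hθ, ← hθbase, ← hθbase, ← map_mul, ht j]
  have hunit' : IsUnit (θ (coverIHat (X none) (X (some a)) (X (some b)) (X (some c)) (X (some d))
      (X (some e)))) := by
    rw [hθ, ← hι]; exact hunit
  have hs0' : θ (X none) ≠ 0 := by rw [hθ]; exact hs0
  have hdict := radical_span_coverCentre_eq k n a b c d e hab hac had hae hbc hbd hbe hcd hce hde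
    θ hs0' hunit' (fun j => θU (t j)) hu
  simp only [hθ] at hdict
  have hbridge := cover_comap_radical_oddIdeal_eq_augIdeal k n a b c d e hab hac had hae hbc hbd hbe hcd
    hce hde I ι U σU hs h1 h2 h3 h4 hσ hσι τU τs τb τd τi hτι hp hp5 τbar hτbar
  -- the key identification `√(ψC⁻¹ K) = I_{τ̄} ∩ R₀`
  have hJ : (K.comap ψC).radical = (augIdeal τbar).comap
      (algebraMap (FixedPoints.subalgebra k (FixedPoints.subalgebra k U (Subgroup.zpowers σU))
        (Subgroup.zpowers τbar)) (FixedPoints.subalgebra k U (Subgroup.zpowers σU))) := by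
    ext r
    rw [← Ideal.comap_radical, Ideal.mem_comap, Ideal.mem_comap, ← hbridge, Ideal.mem_comap]
    change ψC r ∈ K.radical ↔ ((r : FixedPoints.subalgebra k U (Subgroup.zpowers σU)) : U) ∈ _
    rw [← hdict]
    constructor
    · rintro ⟨m, hm⟩
      refine ⟨m, ?_⟩
      rw [← hθψ, ← map_pow]
      have h := Ideal.mem_map_of_mem θU hm
      rw [hK, Ideal.map_span] at h
      have hset : (θU : C → U) '' (base '' {X a, X b, X c, X d} ∪ Set.range t) =
          (fun F => algebraMap _ U (Ideal.Quotient.mk I (coverSubst k n a b c d F))) ''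
            {X a, X b, X c, X d} ∪ Set.range (fun j => θU (t j)) := by
        rw [show ((θU : C → U) '' (base '' {X a, X b, X c, X d} ∪ Set.range t)) =
            (fun z => ((eE z : FixedPoints.subalgebra k U (Subgroup.zpowers τU)) : U)) ''
              (base '' {X a, X b, X c, X d} ∪ Set.range t) from Set.image_congr' fun y => hθU y]
        have := himage
        simp only [hθ] at this
        exact this
      rw [hset] at h
      exact h
    · intro hr
      refine JordanFour.mem_radical_span_of_model k (FixedPoints.subalgebra k U (Subgroup.zpowers τU))
        eE _ (ψC r) ?_
      rw [himage]
      simp only [hθ]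
      rw [hψval]
      exact hr
  -- ### assemble
  refine ⟨FixedPoints.subalgebra k (FixedPoints.subalgebra k U (Subgroup.zpowers σU))
      (Subgroup.zpowers τbar), inferInstance, (K.comap ψC).radical, ψC, ?_, ?_,
    Ideal.radical_isRadical _, ?_, rfl⟩
  · -- injective
    intro r r' h
    have h' := congrArg (fun y => ((eE y : FixedPoints.subalgebra k U (Subgroup.zpowers τU)) : U)) h
    simp only [hψval] at h'
    exact Subtype.ext (Subtype.ext h')
  · -- range
    intro y
    constructor
    · rintro ⟨r, rfl⟩
      rw [hψval]
      exact (mem_fixedPoints_zpowers_iff_apply_eq σU _).mp r.1.2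
    · intro hy
      have hyτ : τU ((eE y : FixedPoints.subalgebra k U (Subgroup.zpowers τU)) : U) =
          ((eE y : FixedPoints.subalgebra k U (Subgroup.zpowers τU)) : U) :=
        (mem_fixedPoints_zpowers_iff_apply_eq τU _).mp (eE y).2
      let v : FixedPoints.subalgebra k U (Subgroup.zpowers σU) :=
        ⟨((eE y : FixedPoints.subalgebra k U (Subgroup.zpowers τU)) : U),
          (mem_fixedPoints_zpowers_iff_apply_eq σU _).mpr hy⟩
      have hv : τbar v = v := Subtype.ext (by rw [hτbar]; exact hyτ)
      refine ⟨⟨v, (mem_fixedPoints_zpowers_iff_apply_eq τbar v).mpr hv⟩, ?_⟩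
      apply eE.injective
      rw [hψ]
      exact Subtype.ext rfl
  · -- regular blow-up
    rw [hJ]
    exact InvolutionExit.isRegular_affineBlowup_comap_augIdeal_twice h2k σU τU hp hσp hττ τbar hτbar

end Summit.ResolutionOfSingularities.ResolutionOfSingularities.Theorems.WildQuotientResolution.JordanFive

end
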